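import Summits.QuantumFields.YangMills.Theorems.ConvexGribovBodyNonSimplyConnectedLatticeGapStubBoxInfluenceInward
import Summits.Ventures.YMGap.RobustBall.PerturbedExistence
import Summits.Ventures.YMGap.RobustBall.SummableSpecification
import HarnessLib

/-!
# Venture YMGap, track ROBUST-BALL — ONE STATE, step 9: TRANSLATION COVARIANCE of the perturbed specifications
# and translation invariance of the one state of a translation-covariant member

HONEST FRAMING. WHAT THIS IS: a venture file (cell `pub-ymgap`, track Y2 ROBUST-BALL, seat ds-3), the `W`-twin of the
tree's translation covariance of the Wilson specification (`NonSimplyConnectedLatticeGap.ymSpecification_map_configShift`,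
`map_configShift_mem_ymGibbsMeasures`; Georgii 2011 §5.1 (5.5)–(5.10): Gibbsian specifications of shift-invariant
potentials are shift-invariant, and so is their set of Gibbs measures). Three layers:
* GENERIC (`Covariance.map_configShift_mem_gibbsMeasures`, `Covariance.isZdTranslationInvariant_of_subsingleton`): for ANY
  specification `γ` on `G^{links(ℤ^d)}` whose kernels are translation covariant — `γ_Λ(· | η) ∘ θ_v⁻¹ = γ_{Λ+v}(· | θ_v η)`
  — the translate of a DLR state is a DLR state, hence in the uniqueness regime THE ONE STATE IS TRANSLATION INVARIANT
  (`IsZdTranslationInvariant`);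
* TILTED PRODUCT-HAAR KERNELS (`Covariance.integral_tilted_glueWith_shift`, `Covariance.tilted_glueWith_map_configShift`):
  every kernel of the cell's shape `(⊗_{e ∈ Λ} Haar ∘ glue(·, η))` tilted by a continuous energy `φ_Λ` is covariant as
  soon as the energies are, `φ_{Λ+v} ∘ θ_v = φ_Λ` (re-index the links of `Λ + v` along `e ↦ e + v`, product Haar is
  preserved, gluing commutes with the shift — the tree's proof of `integral_ymSpecification_shift` verbatim with the
  Wilson energy replaced by `φ`);
* THE CARRIERS: rb-p1's tier-1 specification `perturbedYM ρ β W supp` is covariant whenever the finite-volume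
  Hamiltonians are (`H^W_{Λ+v} ∘ θ_v = H^W_Λ`, e.g. for a translation-covariant potential with a translation-covariant
  support family, `hamiltonianIn_shift`): `perturbedYM_map_configShift`, `map_configShift_mem_perturbedGibbsMeasures`,
  `isZdTranslationInvariant_of_subsingleton_perturbedYM`; the tier-2 specification `perturbedYMS ρ β W` (link-summable,
  possibly infinite-range `W`) is covariant for every translation-covariant potential `W_{X+v}(θ_v U) = W_X(U)`
  (`perturbedEnergyS_shift`, `perturbedYMS_map_configShift`, `map_configShift_mem_perturbedGibbsMeasuresS`,
  `isZdTranslationInvariant_of_subsingleton_perturbedYMS`).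
WHAT THIS IS NOT: no claim that a particular member is covariant (that is `OneStateInvariant.lean`), no estimate;
lattice statements only, nothing about the continuum limit or the Clay Millennium problem.

References: H.-O. Georgii, *Gibbs Measures and Phase Transitions* (2011), §5.1, (5.5)–(5.10); E. Seiler, LNP 159
(1982), Ch. 2; the tree's `ConvexGribovBodyNonSimplyConnectedLatticeGapStubBoxInfluenceInward.lean` and
`ContractibleFibreFibreToTorusFibreTranslationInvarianceOfCA.lean` (Wilson templates, followed line by line).
-/

noncomputable section

open MeasureTheory Filter Function
open Literature.Probability.LatticeModels hiding configShift configShift_apply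
open Literature.MathematicalPhysics.QuantumLattice
open Literature.MathematicalPhysics.QuantumFieldTheory hiding ZdEdge
open Summit.QuantumFields.YangMills.Theorems.NonSimplyConnectedLatticeGap
  (wilsonBoundaryAction_shift configShift_configShift_neg configShift_neg_configShift)

namespace Summit.Ventures.YMGap.RobustBall

namespace Covariance

/-! ### Generic: a translation-covariant specification has a translation-stable set of DLR states -/

section Generic

variable {d : ℕ} {G : Type*} [MeasurableSpace G]

/-- `Λ' = (Λ' − v) + v` for finite link sets. [folklore] -/
theorem map_edgeShift_neg_map (Λ' : Finset (ZdEdge d)) (v : Site d) :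
    (Λ'.map (edgeShift (-v)).toEmbedding).map (edgeShift v).toEmbedding = Λ' := by
  rw [Finset.map_map]
  have h : (edgeShift (d := d) (-v)).toEmbedding.trans (edgeShift v).toEmbedding = Function.Embedding.refl _ := by
    ext e : 1
    simp [edgeShift_apply]
  rw [h, Finset.map_refl]

/-- **Translation covariance of the kernels ⇒ translation stability of the DLR states.** If `γ` is a specification
on `G^{links(ℤ^d)}` with `γ_Λ(· | η) ∘ θ_v⁻¹ = γ_{Λ+v}(· | θ_v η)` for all `Λ, η, v`, then for every Gibbs measure `μ` of
`γ` the translate `μ ∘ θ_v⁻¹ = μ.map (configShift v)` is a Gibbs measure of `γ`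
(`∫ γ_{Λ'}(A | η') d(μ∘θ_v⁻¹) = ∫ γ_{Λ'−v}(θ_v⁻¹A | η) dμ = μ(θ_v⁻¹ A)`; Georgii 2011, §5.1, (5.7)–(5.10)). [folklore] -/
theorem map_configShift_mem_gibbsMeasures {γ : Specification (ZdEdge d) G} (hγ : IsSpecification γ)
    (hcov : ∀ (Λ : Finset (ZdEdge d)) (v : Site d) (η : LGConfig d G),
      (γ Λ η).map (configShift v) = γ (Λ.map (edgeShift v).toEmbedding) (configShift v η))
    {μ : Measure (LGConfig d G)} (hμ : μ ∈ gibbsMeasures γ) (v : Site d) :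
    μ.map (configShift v) ∈ gibbsMeasures γ := by
  rw [mem_gibbsMeasures_iff] at hμ ⊢
  haveI := hμ.isProbabilityMeasure
  refine ⟨Measure.isProbabilityMeasure_map (configShift v).measurable.aemeasurable, fun Λ' A hA => ?_⟩
  set Λ : Finset (ZdEdge d) := Λ'.map (edgeShift (-v)).toEmbedding with hΛ
  have hΛ' : Λ' = Λ.map (edgeShift v).toEmbedding := (map_edgeShift_neg_map Λ' v).symm
  rw [lintegral_map (hγ.measurable_coe Λ' hA) (configShift v).measurable,
    Measure.map_apply (configShift v).measurable hA]
  have hpt : ∀ η : LGConfig d G, γ Λ' (configShift v η) A = γ Λ η (configShift v ⁻¹' A) := fun η => by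
    rw [hΛ', ← hcov Λ v η, Measure.map_apply (configShift v).measurable hA]
  simp_rw [hpt]
  exact hμ.2 Λ _ ((configShift v).measurable hA)

/-- ★ **DLR UNIQUENESS FORCES TRANSLATION INVARIANCE** (generic): if the kernels of `γ` are translation covariant
and `𝒢(γ)` has at most one element, every Gibbs measure of `γ` is invariant under all lattice translations
(`IsZdTranslationInvariant`; Georgii 2011, §5.1). [folklore] -/
theorem isZdTranslationInvariant_of_subsingleton {γ : Specification (ZdEdge d) G} (hγ : IsSpecification γ)
    (hcov : ∀ (Λ : Finset (ZdEdge d)) (v : Site d) (η : LGConfig d G),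
      (γ Λ η).map (configShift v) = γ (Λ.map (edgeShift v).toEmbedding) (configShift v η))
    (hsub : (gibbsMeasures γ).Subsingleton) {μ : Measure (LGConfig d G)} (hμ : μ ∈ gibbsMeasures γ) :
    IsZdTranslationInvariant μ :=
  fun v => hsub (map_configShift_mem_gibbsMeasures hγ hcov hμ v) hμ

end Generic

/-! ### Tilted product-Haar kernels with a translation-covariant energy are translation covariant -/

section Tilted

variable {d : ℕ} {G : Type*} [Group G] [TopologicalSpace G] [IsTopologicalGroup G] [CompactSpace G]
  [MeasurableSpace G] [BorelSpace G] [SecondCountableTopology G]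

/-- **Integral formula** for a product-Haar kernel glued with `η` and tilted by a continuous energy `φ`:
`∫ F d((⊗Haar ∘ glue(·,η)) tilted by φ) = (∫ F(ζη_{Λᶜ}) e^{φ(ζη_{Λᶜ})} dζ) / (∫ e^{φ(ζη_{Λᶜ})} dζ)`
(Georgii 2011, Def. 2.9; the tree's `integral_perturbedYM` for a general energy). [folklore] -/
theorem integral_tilted_glueWith (φ : LGConfig d G → ℝ) (hφc : Continuous φ) (Λ : Finset (ZdEdge d))
    {F : LGConfig d G → ℝ} (hF : Measurable F) (η : LGConfig d G) :
    ∫ U, F U ∂(((Measure.pi fun _ : ↥Λ => haarProbability G).map (glueWith Λ · η)).tilted φ) =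
      (∫ ζ, F (glueWith Λ ζ η) * Real.exp (φ (glueWith Λ ζ η)) ∂(Measure.pi fun _ : ↥Λ => haarProbability G)) /
        ∫ ζ, Real.exp (φ (glueWith Λ ζ η)) ∂(Measure.pi fun _ : ↥Λ => haarProbability G) := by
  have hg : Measurable (glueWith Λ · η) := measurable_glueWith Λ η
  have hw : Continuous fun U : LGConfig d G => Real.exp (φ U) := Real.continuous_exp.comp hφc
  rw [integral_tilted, integral_map hg.aemeasurable hw.aestronglyMeasurable, integral_map hg.aemeasurable]
  · simp only [smul_eq_mul]
    rw [← integral_div]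
    refine congrArg _ (funext fun ζ => ?_)
    ring
  · exact ((hw.measurable.div_const _).mul hF).aestronglyMeasurable

/-- **Translation covariance of tilted product-Haar kernels (integral form).** If the energies of `Λ` and
`Λ + v` are related by `φ' ∘ θ_v = φ`, then `∫ F dγ^{φ'}_{Λ+v}(· | θ_v η) = ∫ F ∘ θ_v dγ^{φ}_Λ(· | η)`: re-index the
links of `Λ + v` along `e ↦ e + v` (product Haar is preserved, `measurePreserving_piCongrLeft`), gluing commutes
with the shift (the tree's `integral_ymSpecification_shift`, verbatim with the Wilson energy replaced by `φ`;
Georgii 2011, §5.1, (5.5)–(5.7)). [folklore] -/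
theorem integral_tilted_glueWith_shift (φ φ' : LGConfig d G → ℝ) (hφc : Continuous φ) (hφc' : Continuous φ')
    (Λ : Finset (ZdEdge d)) (v : Site d) (hcov : ∀ U, φ' (configShift v U) = φ U)
    {F : LGConfig d G → ℝ} (hF : Measurable F) (η : LGConfig d G) :
    ∫ U, F U ∂(((Measure.pi fun _ : ↥(Λ.map (edgeShift v).toEmbedding) => haarProbability G).map
        (glueWith (Λ.map (edgeShift v).toEmbedding) · (configShift v η))).tilted φ') =
      ∫ U, F (configShift v U) ∂(((Measure.pi fun _ : ↥Λ => haarProbability G).map (glueWith Λ · η)).tilted φ) := by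
  set Λ' := Λ.map (edgeShift v).toEmbedding with hΛ'
  -- re-index the links of `Λ` along the shift: `Λ ≃ Λ + v`, `e ↦ e + v`
  set eΛ : ↥Λ ≃ ↥Λ' := (edgeShift v).subtypeEquiv fun _ => (Finset.mem_map' (edgeShift v).toEmbedding).symm
  set Ψ : (↥Λ → G) ≃ᵐ (↥Λ' → G) := MeasurableEquiv.piCongrLeft (fun _ => G) eΛ
  have hΨm : MeasurePreserving Ψ.symm (Measure.pi fun _ : ↥Λ' => haarProbability G)
      (Measure.pi fun _ : ↥Λ => haarProbability G) :=
    (measurePreserving_piCongrLeft (fun _ : ↥Λ' => haarProbability G) eΛ).symm Ψ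
  -- gluing commutes with the shift
  have hglue : ∀ ζ' : ↥Λ' → G, configShift v (glueWith Λ (Ψ.symm ζ') η) = glueWith Λ' ζ' (configShift v η) := by
    intro ζ'
    funext e'
    rw [Literature.MathematicalPhysics.QuantumLattice.configShift_apply]
    by_cases h' : e' ∈ Λ'
    · have h₀ : (e'.1 - v, e'.2) ∈ Λ := by
        rwa [hΛ', Finset.mem_map_equiv, edgeShift_symm_apply] at h'
      rw [glueWith_apply_mem _ _ _ h₀, glueWith_apply_mem _ _ _ h']
      change ζ' (eΛ ⟨(e'.1 - v, e'.2), h₀⟩) = ζ' ⟨e', h'⟩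
      congr 1
      exact Subtype.ext (Prod.ext (sub_add_cancel e'.1 v) rfl)
    · have h₀ : (e'.1 - v, e'.2) ∉ Λ := fun h => h' (by
        rw [hΛ', Finset.mem_map_equiv, edgeShift_symm_apply]; exact h)
      rw [glueWith_apply_not_mem _ _ _ h₀, glueWith_apply_not_mem _ _ _ h',
        Literature.MathematicalPhysics.QuantumLattice.configShift_apply]
  -- the energy is covariant
  have hS : ∀ ζ' : ↥Λ' → G, φ (glueWith Λ (Ψ.symm ζ') η) = φ' (glueWith Λ' ζ' (configShift v η)) := fun ζ' => by
    rw [← hglue]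
    exact (hcov _).symm
  rw [integral_tilted_glueWith φ' hφc' Λ' hF,
    integral_tilted_glueWith φ hφc Λ (F := fun U => F (configShift v U)) (hF.comp (configShift v).measurable),
    ← hΨm.integral_comp', ← hΨm.integral_comp']
  simp only [hglue, hS]

/-- **Translation covariance of tilted product-Haar kernels (push-forward form)**:
`γ^{φ}_Λ(· | η) ∘ θ_v⁻¹ = γ^{φ'}_{Λ+v}(· | θ_v η)` when `φ' ∘ θ_v = φ` (Georgii 2011, §5.1, (5.7)). [folklore] -/
theorem tilted_glueWith_map_configShift (φ φ' : LGConfig d G → ℝ) (hφc : Continuous φ) (hφc' : Continuous φ')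
    (Λ : Finset (ZdEdge d)) (v : Site d) (hcov : ∀ U, φ' (configShift v U) = φ U) (η : LGConfig d G) :
    (((Measure.pi fun _ : ↥Λ => haarProbability G).map (glueWith Λ · η)).tilted φ).map (configShift v) =
      ((Measure.pi fun _ : ↥(Λ.map (edgeShift v).toEmbedding) => haarProbability G).map
        (glueWith (Λ.map (edgeShift v).toEmbedding) · (configShift v η))).tilted φ' := by
  set Λ' := Λ.map (edgeShift v).toEmbedding with hΛ'
  haveI h1 : IsProbabilityMeasure (((Measure.pi fun _ : ↥Λ => haarProbability G).map (glueWith Λ · η)).tilted φ) :=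
    isProbabilityMeasure_tilted_map_glueWith_pi (V := ZdEdge d) (haarProbability G) Λ η hφc.measurable
      (exists_bound_of_continuous hφc)
  haveI h2 : IsProbabilityMeasure (((Measure.pi fun _ : ↥Λ' => haarProbability G).map
      (glueWith Λ' · (configShift v η))).tilted φ') :=
    isProbabilityMeasure_tilted_map_glueWith_pi (V := ZdEdge d) (haarProbability G) Λ' (configShift v η)
      hφc'.measurable (exists_bound_of_continuous hφc')
  haveI : IsProbabilityMeasure ((((Measure.pi fun _ : ↥Λ => haarProbability G).map (glueWith Λ · η)).tilted φ).map
      (configShift v)) :=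
    Measure.isProbabilityMeasure_map (configShift v).measurable.aemeasurable
  ext A hA
  have hind : Measurable (A.indicator (1 : LGConfig d G → ℝ)) := measurable_one.indicator hA
  have h1 : ((((Measure.pi fun _ : ↥Λ => haarProbability G).map (glueWith Λ · η)).tilted φ).map (configShift v)).real A =
      (((Measure.pi fun _ : ↥Λ' => haarProbability G).map (glueWith Λ' · (configShift v η))).tilted φ').real A := by
    rw [← integral_indicator_one hA, ← integral_indicator_one hA, integral_map_equiv,
      integral_tilted_glueWith_shift φ φ' hφc hφc' Λ v hcov hind η]
  rw [measureReal_def, measureReal_def, ENNReal.toReal_eq_toReal_iff' (measure_ne_top _ _)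
    (measure_ne_top _ _)] at h1
  exact h1

end Tilted

/-! ### The carriers: tier 1 (`perturbedYM`) and tier 2 (`perturbedYMS`) -/

section Carriers

variable {d N : ℕ} {G : Type*} [Group G] (ρ : G →* Matrix (Fin N) (Fin N) ℂ)

omit [Group G] in
/-- **A translation-covariant potential with a translation-covariant support family has translation-covariant
finite-volume Hamiltonians**: `H^W_{Λ+v}(θ_v U) = H^W_Λ(U)` (Georgii 2011, (5.5)–(5.6)). [folklore] -/
theorem hamiltonianIn_shift [MeasurableSpace G] {W : Potential (ZdEdge d) G}
    {supp : Finset (ZdEdge d) → Finset (Finset (ZdEdge d))}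
    (hW : ∀ (v : Site d) (X : Finset (ZdEdge d)) (U : LGConfig d G),
      W (X.map (edgeShift v).toEmbedding) (configShift v U) = W X U)
    (hsupp : ∀ (v : Site d) (Λ : Finset (ZdEdge d)),
      supp (Λ.map (edgeShift v).toEmbedding) = (supp Λ).map (Equiv.finsetCongr (edgeShift v)).toEmbedding)
    (Λ : Finset (ZdEdge d)) (v : Site d) (U : LGConfig d G) :
    hamiltonianIn W supp (Λ.map (edgeShift v).toEmbedding) (configShift v U) = hamiltonianIn W supp Λ U := by
  classical
  simp only [hamiltonianIn, hsupp, Finset.filter_map, Finset.sum_map]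
  refine Finset.sum_congr ?_ fun X _ => ?_
  · congr 1
    ext X
    simp only [Function.comp_apply, Equiv.coe_toEmbedding, Equiv.finsetCongr_apply, ← Finset.map_inter,
      Finset.map_nonempty]
  · rw [Equiv.coe_toEmbedding, Equiv.finsetCongr_apply, hW]

/-- **Translation covariance of the tier-1 perturbed energy**: if the finite-volume Hamiltonians are covariant,
`φ^W_{Λ+v}(θ_v U) = φ^W_Λ(U)` (the Wilson part by the tree's `wilsonBoundaryAction_shift`). [folklore] -/
theorem perturbedEnergy_shift [MeasurableSpace G] (β : ℝ) {W : Potential (ZdEdge d) G}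
    {supp : Finset (ZdEdge d) → Finset (Finset (ZdEdge d))} {Λ : Finset (ZdEdge d)} {v : Site d}
    (hH : ∀ U : LGConfig d G,
      hamiltonianIn W supp (Λ.map (edgeShift v).toEmbedding) (configShift v U) = hamiltonianIn W supp Λ U)
    (U : LGConfig d G) :
    perturbedEnergy ρ β W supp (Λ.map (edgeShift v).toEmbedding) (configShift v U) = perturbedEnergy ρ β W supp Λ U := by
  simp only [perturbedEnergy, wilsonBoundaryAction_shift, hH]

/-- **Translation covariance of the tier-2 perturbed energy** for a translation-covariant potential
`W_{X+v}(θ_v U) = W_X(U)`: `φ^W_{Λ+v}(θ_v U) = φ^W_Λ(U)` (the series over all finite link sets meeting the volume is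
re-indexed along `X ↦ X + v`). [folklore] -/
theorem perturbedEnergyS_shift [MeasurableSpace G] (β : ℝ) {W : Potential (ZdEdge d) G}
    (hW : ∀ (v : Site d) (X : Finset (ZdEdge d)) (U : LGConfig d G),
      W (X.map (edgeShift v).toEmbedding) (configShift v U) = W X U)
    (Λ : Finset (ZdEdge d)) (v : Site d) (U : LGConfig d G) :
    perturbedEnergyS ρ β W (Λ.map (edgeShift v).toEmbedding) (configShift v U) = perturbedEnergyS ρ β W Λ U := by
  classical
  simp only [perturbedEnergyS, wilsonBoundaryAction_shift]
  congr 1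
  rw [← (Equiv.finsetCongr (edgeShift v)).tsum_eq]
  refine tsum_congr fun X => ?_
  simp only [Equiv.finsetCongr_apply, ← Finset.map_inter, Finset.map_nonempty, hW]

variable [TopologicalSpace G] [IsTopologicalGroup G] [CompactSpace G] [MeasurableSpace G] [BorelSpace G]
  [SecondCountableTopology G]

/-- ★ **Translation covariance of the tier-1 perturbed specification**: if the member's finite-volume Hamiltonians
are translation covariant (continuous `ρ`, continuous terms), `γ^W_Λ(· | η) ∘ θ_v⁻¹ = γ^W_{Λ+v}(· | θ_v η)`
(Georgii 2011, §5.1, (5.7)). [folklore] -/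
theorem perturbedYM_map_configShift (hρ : Continuous ρ) (β : ℝ) {W : Potential (ZdEdge d) G}
    (hWc : ∀ X, Continuous (W X)) (supp : Finset (ZdEdge d) → Finset (Finset (ZdEdge d)))
    (Λ : Finset (ZdEdge d)) (v : Site d)
    (hH : ∀ U : LGConfig d G,
      hamiltonianIn W supp (Λ.map (edgeShift v).toEmbedding) (configShift v U) = hamiltonianIn W supp Λ U)
    (η : LGConfig d G) :
    (perturbedYM ρ β W supp Λ η).map (configShift v) =
      perturbedYM ρ β W supp (Λ.map (edgeShift v).toEmbedding) (configShift v η) :=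
  tilted_glueWith_map_configShift _ _ (continuous_perturbedEnergy ρ hρ β hWc supp Λ)
    (continuous_perturbedEnergy ρ hρ β hWc supp _) Λ v (perturbedEnergy_shift ρ β hH) η

/-- ★ **Tier 1: the translate of a DLR state of a translation-covariant member is a DLR state** (continuous terms
reading their own links, locally finite support, covariant Hamiltonians). [folklore] -/
theorem map_configShift_mem_perturbedGibbsMeasures [T2Space G] (hρ : Continuous ρ) (β : ℝ)
    {W : Potential (ZdEdge d) G} (hWc : ∀ X, Continuous (W X)) (hdep : ∀ X, DependsOn (W X) (↑X : Set (ZdEdge d)))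
    {supp : Finset (ZdEdge d) → Finset (Finset (ZdEdge d))} (hsupp : W.IsSupportedBy supp)
    (hH : ∀ (Λ : Finset (ZdEdge d)) (v : Site d) (U : LGConfig d G),
      hamiltonianIn W supp (Λ.map (edgeShift v).toEmbedding) (configShift v U) = hamiltonianIn W supp Λ U)
    {μ : Measure (LGConfig d G)} (hμ : μ ∈ perturbedGibbsMeasures (d := d) ρ β W supp) (v : Site d) :
    μ.map (configShift v) ∈ perturbedGibbsMeasures (d := d) ρ β W supp :=
  map_configShift_mem_gibbsMeasures
    (isSpecification_perturbedYM ρ hρ β (fun X => ⟨hdep X, (hWc X).measurable⟩)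
      (fun X => exists_bound_of_continuous (hWc X)) hsupp)
    (fun Λ v η => perturbedYM_map_configShift ρ hρ β hWc supp Λ v (hH Λ v) η) hμ v

/-- ★★ **Tier 1: DLR UNIQUENESS FORCES TRANSLATION INVARIANCE OF THE ONE STATE of a translation-covariant member.**
[folklore] -/
theorem isZdTranslationInvariant_of_subsingleton_perturbedYM [T2Space G] (hρ : Continuous ρ) (β : ℝ)
    {W : Potential (ZdEdge d) G} (hWc : ∀ X, Continuous (W X)) (hdep : ∀ X, DependsOn (W X) (↑X : Set (ZdEdge d)))
    {supp : Finset (ZdEdge d) → Finset (Finset (ZdEdge d))} (hsupp : W.IsSupportedBy supp)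
    (hH : ∀ (Λ : Finset (ZdEdge d)) (v : Site d) (U : LGConfig d G),
      hamiltonianIn W supp (Λ.map (edgeShift v).toEmbedding) (configShift v U) = hamiltonianIn W supp Λ U)
    (hsub : (perturbedGibbsMeasures (d := d) ρ β W supp).Subsingleton) {μ : Measure (LGConfig d G)}
    (hμ : μ ∈ perturbedGibbsMeasures (d := d) ρ β W supp) : IsZdTranslationInvariant μ :=
  fun v => hsub (map_configShift_mem_perturbedGibbsMeasures ρ hρ β hWc hdep hsupp hH hμ v) hμ

/-- ★ **Translation covariance of the tier-2 perturbed specification** for a translation-covariant link-summable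
potential with continuous terms: `γ^W_Λ(· | η) ∘ θ_v⁻¹ = γ^W_{Λ+v}(· | θ_v η)`. [folklore] -/
theorem perturbedYMS_map_configShift (hρ : Continuous ρ) (β : ℝ) {W : Potential (ZdEdge d) G}
    {B : Finset (ZdEdge d) → ℝ} (hB : IsLinkSummable W B) (hWc : ∀ X, Continuous (W X))
    (hW : ∀ (v : Site d) (X : Finset (ZdEdge d)) (U : LGConfig d G),
      W (X.map (edgeShift v).toEmbedding) (configShift v U) = W X U)
    (Λ : Finset (ZdEdge d)) (v : Site d) (η : LGConfig d G) :
    (perturbedYMS ρ β W Λ η).map (configShift v) =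
      perturbedYMS ρ β W (Λ.map (edgeShift v).toEmbedding) (configShift v η) :=
  tilted_glueWith_map_configShift _ _ (continuous_perturbedEnergyS ρ hρ β hB hWc Λ)
    (continuous_perturbedEnergyS ρ hρ β hB hWc _) Λ v (perturbedEnergyS_shift ρ β hW Λ v) η

/-- ★ **Tier 2: the translate of a DLR state of a translation-covariant link-summable member is a DLR state.**
[folklore] -/
theorem map_configShift_mem_perturbedGibbsMeasuresS [T2Space G] (hρ : Continuous ρ) (β : ℝ)
    {W : Potential (ZdEdge d) G} {B : Finset (ZdEdge d) → ℝ} (hB : IsLinkSummable W B)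
    (hWc : ∀ X, Continuous (W X)) (hdep : ∀ X, DependsOn (W X) (↑X : Set (ZdEdge d)))
    (hW : ∀ (v : Site d) (X : Finset (ZdEdge d)) (U : LGConfig d G),
      W (X.map (edgeShift v).toEmbedding) (configShift v U) = W X U)
    {μ : Measure (LGConfig d G)} (hμ : μ ∈ perturbedGibbsMeasuresS (d := d) ρ β W) (v : Site d) :
    μ.map (configShift v) ∈ perturbedGibbsMeasuresS (d := d) ρ β W :=
  map_configShift_mem_gibbsMeasures (isSpecification_perturbedYMS ρ hρ β hB hWc hdep)
    (fun Λ v η => perturbedYMS_map_configShift ρ hρ β hB hWc hW Λ v η) hμ v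

/-- ★★ **Tier 2: DLR UNIQUENESS FORCES TRANSLATION INVARIANCE OF THE ONE STATE of a translation-covariant
link-summable (possibly infinite-range) member.** [folklore] -/
theorem isZdTranslationInvariant_of_subsingleton_perturbedYMS [T2Space G] (hρ : Continuous ρ) (β : ℝ)
    {W : Potential (ZdEdge d) G} {B : Finset (ZdEdge d) → ℝ} (hB : IsLinkSummable W B)
    (hWc : ∀ X, Continuous (W X)) (hdep : ∀ X, DependsOn (W X) (↑X : Set (ZdEdge d)))
    (hW : ∀ (v : Site d) (X : Finset (ZdEdge d)) (U : LGConfig d G),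
      W (X.map (edgeShift v).toEmbedding) (configShift v U) = W X U)
    (hsub : (perturbedGibbsMeasuresS (d := d) ρ β W).Subsingleton) {μ : Measure (LGConfig d G)}
    (hμ : μ ∈ perturbedGibbsMeasuresS (d := d) ρ β W) : IsZdTranslationInvariant μ :=
  fun v => hsub (map_configShift_mem_perturbedGibbsMeasuresS ρ hρ β hB hWc hdep hW hμ v) hμ

end Carriers

end Covariance

end Summit.Ventures.YMGap.RobustBall

end
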